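import Summits.QuantumFields.BalabanUV.Beta.GAN24.JointPeriodicCellSwap
import Summits.QuantumFields.BalabanUV.Beta.GAN24.FaceWordsDeepCurrents

/-!
# `BalabanUV.Beta.GAN24.FaceWordSwapGeneric` — binder row G-an2-4 ∕ (CONV-C), W-slot (α-0), typer's PART VI row **T6-VAL**, the (γ) hand's letters **K7-a ∕ K7-0**:
# **THE SWAPPED EXCHANGE FACE WORD IS THE DIRECT WORD OF THE EXCHANGED BOND DIRECTIONS** — for ANY local stencil family `S` with `N`-covariant slots and ANY decaying
# `N`-invariant middle kernel `X` (common rate), `Σ_{rr∈box N} Σ'_t χ(rr_μ)χ(t_ν)·FF[(S ν t ∘ X) ∘ S μ rr] = Σ_{t∈box N} Σ'_rr χ(t_ν)χ(rr_μ)·FF[(S ν t ∘ X) ∘ S μ rr]` — leaf-06 K4a moves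
# the period-`N` cell from the right bond to the left bond (this lineage's g56 `FaceWordEESwapDeep` §1 VERBATIM, RE-CUT into its own light file so that the LEVEL-0 twin
# `FaceWordEESwapZero` can import it without the levels-`≥ 1` value chain; g56's `FaceWordEESwapDeep` v2 imports this file instead of restating §1)
# (G-an2-4 CRUX TEAM (2), seat `b2b-balaban-gan24-formalise-leaf-06` = the (γ) hand, gen 57 re-cut of gen 56's text; journal [GAN24LEAF06-G57-INTENT-4])

NOT IN PRINT; OUR BOOKKEEPING ([folklore] BY NAME over leaf-06 K4a `JointPeriodicCellSwap.sum_box_tsum_swap_weight` and leaf-02 Part 45 `FaceWordsDeepCurrents.mixed_translate ∕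
tsum_weightPair_shiftK ∕ summable_word_fine ∕ summable_word_fine_left`; 0 `def`, 0 cited fact, 0 `def … : Prop`, 0 sorry).  HONEST FRAMING (cell contract, verbatim): «discharging
`BetaPertH` makes Bałaban's UV stability UNCONDITIONAL — a real constructive-QFT result; it is NOT the continuum limit and NOT the Clay problem.»  HONEST DEPENDENCY (verbatim):
«continuum YM on T⁴ ⇐ BetaPertH ∧ nine spine estimates (0/9 proved); BetaPertH ⇐ (D1) ∧ (D4) ∧ CAP+tail; G-an2-4 gates asym, D1 and NE2/3/4.»
Asserts NO value of any table; discharges NOTHING of `hX` ∕ `hXu` ∕ (C)_{≥1} ∕ `hB0` ∕ `hBF` ∕ (Q-L); NEVER «G-an2-4 closed» as (CONV-C); NOT D1, NOT `BetaPertH`, NOT continuum, NOT Clay.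
2026-08-24; no existing file touched.
-/

noncomputable section

open Finset
open scoped BigOperators
open Literature.MathematicalPhysics.QuantumFieldTheory
open Literature.MathematicalPhysics.QuantumFieldTheory.Balaban1983to89
open Literature.MathematicalPhysics.QuantumFieldTheory.Balaban1983to89.Beta
open ExpKernelCalculus (Site MKer Decays BiLoc shiftK comp)
open OneStepResolventKernel (Fib LocStencil)
open AffineAveraging (box toSite)
open Summit.QuantumFields.BalabanUV.Beta.GAN24.JointPeriodicCellSwap (sum_box_tsum_swap_weight)
open Summit.QuantumFields.BalabanUV.Beta.GAN24.FaceWordsDeepCurrents (mixed_translate tsum_weightPair_shiftK summable_word_fine summable_word_fine_left)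

namespace Summit.QuantumFields.BalabanUV.Beta.GAN24.FaceWordSwapGeneric

variable {d : ℕ}

section Generic

variable {N : ℕ} [NeZero N] {S : Fin (d + 1) → Site (d + 1) → MKer (d + 1) (Fib d)} {X : MKer (d + 1) (Fib d)} {Cs CX δ : ℝ}

/-- NOT IN PRINT; OUR BOOKKEEPING.  **THE SWAPPED EXCHANGE FACE WORD IS THE DIRECT WORD OF THE EXCHANGED BOND DIRECTIONS** (generic local stencil family `S`, decaying `X`,
common rate, `N`-covariance): `Σ_{rr∈box N} Σ'_t χ(rr_μ)χ(t_ν)·FF[(S ν t ∘ X) ∘ S μ rr] = Σ_{t∈box N} Σ'_rr χ(t_ν)χ(rr_μ)·FF[(S ν t ∘ X) ∘ S μ rr]` — K4a moves the cell from the right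
bond to the left bond. -/
theorem swapWord_eq_directWord (hS : LocStencil S Cs δ) (hX : Decays X CX δ) (hδ : 0 < δ)
    (hSt : ∀ (κ : Fin (d + 1)) (t s : Site (d + 1)), S κ (t + (N : ℤ) • s) = shiftK (-((N : ℤ) • s)) (S κ t))
    (hXt : ∀ s : Site (d + 1), shiftK (-((N : ℤ) • s)) X = X) (μ ν α β : Fin (d + 1)) :
    ∑ rr ∈ box (d + 1) N, ∑' t : Site (d + 1), (if toSite rr μ % (N : ℤ) = (N : ℤ) - 1 then (1 : ℝ) else 0) * (if t ν % (N : ℤ) = (N : ℤ) - 1 then (1 : ℝ) else 0) *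
        ∑' yw : Site (d + 1) × Site (d + 1), (if yw.1 α % (N : ℤ) = (N : ℤ) - 1 then (1 : ℝ) else 0) * (if yw.2 β % (N : ℤ) = (N : ℤ) - 1 then (1 : ℝ) else 0) *
          comp (comp (S ν t) X) (S μ (toSite rr)) yw.1 yw.2 (Sum.inl α) (Sum.inl β) =
      ∑ t ∈ box (d + 1) N, ∑' rr : Site (d + 1), (if toSite t ν % (N : ℤ) = (N : ℤ) - 1 then (1 : ℝ) else 0) * (if rr μ % (N : ℤ) = (N : ℤ) - 1 then (1 : ℝ) else 0) *
        ∑' yw : Site (d + 1) × Site (d + 1), (if yw.1 α % (N : ℤ) = (N : ℤ) - 1 then (1 : ℝ) else 0) * (if yw.2 β % (N : ℤ) = (N : ℤ) - 1 then (1 : ℝ) else 0) *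
          comp (comp (S ν (toSite t)) X) (S μ rr) yw.1 yw.2 (Sum.inl α) (Sum.inl β) := by
  set m : Site (d + 1) × Site (d + 1) → ℝ := fun yw =>
    (if yw.1 α % (N : ℤ) = (N : ℤ) - 1 then (1 : ℝ) else 0) * (if yw.2 β % (N : ℤ) = (N : ℤ) - 1 then (1 : ℝ) else 0) with hmdef
  have hm : ∀ yw, |m yw| ≤ 1 := by
    intro yw; rw [hmdef]; dsimp only; rw [abs_mul]
    have h1 : |(if yw.1 α % (N : ℤ) = (N : ℤ) - 1 then (1 : ℝ) else 0)| ≤ 1 := by split_ifs <;> simp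
    have h2 : |(if yw.2 β % (N : ℤ) = (N : ℤ) - 1 then (1 : ℝ) else 0)| ≤ 1 := by split_ifs <;> simp
    exact (mul_le_mul h1 h2 (abs_nonneg _) zero_le_one).trans (le_of_eq (one_mul 1))
  have hmv : ∀ (s y w : Site (d + 1)), m (y + -((N : ℤ) • s), w + -((N : ℤ) • s)) = m (y, w) := by
    intro s y w
    have e1 : (y + -((N : ℤ) • s)) α % (N : ℤ) = y α % (N : ℤ) := by
      rw [← smul_neg]; simp only [Pi.add_apply, Pi.smul_apply, smul_eq_mul, Int.add_mul_emod_self_left]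
    have e2 : (w + -((N : ℤ) • s)) β % (N : ℤ) = w β % (N : ℤ) := by
      rw [← smul_neg]; simp only [Pi.add_apply, Pi.smul_apply, smul_eq_mul, Int.add_mul_emod_self_left]
    simp only [hmdef, e1, e2]
  have hχ : ∀ (κ : Fin (d + 1)) (t : Site (d + 1)), |(if t κ % (N : ℤ) = (N : ℤ) - 1 then (1 : ℝ) else 0)| ≤ 1 := fun κ t => by split_ifs <;> simp
  -- the two-slot family (cell slot `rr`, free slot `t`)
  set G : Site (d + 1) → Site (d + 1) → ℝ := fun rr t =>
    ∑' yw : Site (d + 1) × Site (d + 1), m yw * comp (comp (S ν t) X) (S μ rr) yw.1 yw.2 (Sum.inl α) (Sum.inl β) with hGdef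
  have hG : ∀ rr t s, G (rr + (N : ℤ) • s) (t + (N : ℤ) • s) = G rr t := by
    intro rr t s
    simp only [hGdef]
    rw [mixed_translate (P := N) (Q := N) (N := N) (DL := S ν) (DR := S μ) (fun u s => hSt ν u s) (fun t s => hSt μ t s) hXt t rr s,
      tsum_weightPair_shiftK m _ (hmv s)]
  have hGa : ∀ rr, Summable fun t => (fun t : Site (d + 1) => (if t ν % (N : ℤ) = (N : ℤ) - 1 then (1 : ℝ) else 0)) t * G rr t :=
    fun rr => summable_word_fine_left (hS μ rr) hX hδ hS ν _ (hχ ν) m hm (Sum.inl α) (Sum.inl β)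
  have hGb : ∀ t, Summable fun rr => (fun rr : Site (d + 1) => (if rr μ % (N : ℤ) = (N : ℤ) - 1 then (1 : ℝ) else 0)) rr * G rr t :=
    fun t => summable_word_fine (hS ν t) hX hδ hS μ _ (hχ μ) m hm (Sum.inl α) (Sum.inl β)
  have key := sum_box_tsum_swap_weight (P := N) (Q := N) G (fun rr : Site (d + 1) => (if rr μ % (N : ℤ) = (N : ℤ) - 1 then (1 : ℝ) else 0))
    (fun t : Site (d + 1) => (if t ν % (N : ℤ) = (N : ℤ) - 1 then (1 : ℝ) else 0)) hG
    (fun rr s => by simp only [Pi.add_apply, Pi.smul_apply, smul_eq_mul, Int.add_mul_emod_self_left])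
    (fun t s => by simp only [Pi.add_apply, Pi.smul_apply, smul_eq_mul, Int.add_mul_emod_self_left]) hGa hGb
  -- reshape both sides to the displayed nesting
  have eL : ∀ rr : Fin (d + 1) → ℕ, (∑' t : Site (d + 1), (if toSite rr μ % (N : ℤ) = (N : ℤ) - 1 then (1 : ℝ) else 0) * (if t ν % (N : ℤ) = (N : ℤ) - 1 then (1 : ℝ) else 0) *
      ∑' yw : Site (d + 1) × Site (d + 1), (if yw.1 α % (N : ℤ) = (N : ℤ) - 1 then (1 : ℝ) else 0) * (if yw.2 β % (N : ℤ) = (N : ℤ) - 1 then (1 : ℝ) else 0) *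
        comp (comp (S ν t) X) (S μ (toSite rr)) yw.1 yw.2 (Sum.inl α) (Sum.inl β)) =
      (if toSite rr μ % (N : ℤ) = (N : ℤ) - 1 then (1 : ℝ) else 0) * ∑' t : Site (d + 1), (if t ν % (N : ℤ) = (N : ℤ) - 1 then (1 : ℝ) else 0) * G (toSite rr) t := by
    intro rr
    rw [← tsum_mul_left]
    exact tsum_congr fun t => by simp only [hGdef, hmdef]; ring
  have eR : ∀ t : Fin (d + 1) → ℕ, (∑' rr : Site (d + 1), (if toSite t ν % (N : ℤ) = (N : ℤ) - 1 then (1 : ℝ) else 0) * (if rr μ % (N : ℤ) = (N : ℤ) - 1 then (1 : ℝ) else 0) *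
      ∑' yw : Site (d + 1) × Site (d + 1), (if yw.1 α % (N : ℤ) = (N : ℤ) - 1 then (1 : ℝ) else 0) * (if yw.2 β % (N : ℤ) = (N : ℤ) - 1 then (1 : ℝ) else 0) *
        comp (comp (S ν (toSite t)) X) (S μ rr) yw.1 yw.2 (Sum.inl α) (Sum.inl β)) =
      (if toSite t ν % (N : ℤ) = (N : ℤ) - 1 then (1 : ℝ) else 0) * ∑' rr : Site (d + 1), (if rr μ % (N : ℤ) = (N : ℤ) - 1 then (1 : ℝ) else 0) * G rr (toSite t) := by
    intro t
    rw [← tsum_mul_left]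
    exact tsum_congr fun rr => by simp only [hGdef, hmdef]; ring
  rw [Finset.sum_congr rfl fun rr _ => eL rr, Finset.sum_congr rfl fun t _ => eR t]
  exact key

end Generic

end Summit.QuantumFields.BalabanUV.Beta.GAN24.FaceWordSwapGeneric

end
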